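import Literature.MathematicalPhysics.QuantumLattice.TranslationInvariantStatePairLRO
import Literature.MathematicalPhysics.QuantumLattice.DWaveOrderParameterInfiniteVolume
import Literature.MathematicalPhysics.QuantumLattice.DWaveSourceNNNHoppingEnergyDensityExists
import HarnessLib

/-!
# The finite-`h` FLOOR column of the Koma–Tasaki dictionary: every translation-invariant ground state of the
# pair-sourced `t–t'` Hubbard model has `d`-wave pair LRO `≥ (∂⁻E(h)/2)²` in every box

Topic `Literature/MathematicalPhysics/QuantumLattice` (namespace = path; family `hubbard`). This is item (F)
`SourcedGroundStatePairLROFloor` of `hubbard-cq-lens-transplant-1` g4's `TransplantSketch4.lean` (DICTIONARY §12),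
landed as is for the Hubbard cuprate cell (`hubbard-cq`; lead RULING 79). Notation: `E = dWaveSourceEnergyDensityTT' t' U μ`
(the thermodynamic-limit sourced ground-state energy density; concave, antitone on `[0,∞)`),
`Ψ_h = hubbardTTPrimeSourcedInteraction 1 t' U μ dWaveFormFactor h`, `P_x^d = localPairAt ({0} ∪ unitSteps) dWaveFormFactor x`,
`boxLRO_N(ω) = Re N⁻⁴ Σ_{x,y∈[0,N)²} ω(P_x^d⋆ P_y^d)` (the tree's `dWavePairCorr` in box average).

* `leftDeriv_dWaveSourceEnergyDensityTT'_nonpos`: `∂⁻E(h) ≤ 0` for `h > 0`.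
* `SourcedGroundStatePairLROFloor` / `sourcedGroundStatePairLROFloor_holds`: **for `h > 0` every translation-invariant
  ground state `ω` of `Ψ_h` has `(∂⁻E(h)/2)² ≤ boxLRO_N(ω)` for every `N ≥ 1`** — explicit symmetry breaking floors the
  pair LRO by the square of the SMALLER Griffiths amplitude: `−∂⁻E(h) ≤ 2 Re ω(P₀^d)`
  (`IsMeanEnergyMinimiser.two_mul_re_expect_localPairAt_mem_Icc`, hubbard-cq-p5), `∂⁻E(h) ≤ 0`, and
  `(Re ω(P₀^d))² ≤ boxLRO_N(ω)` for every translation-invariant state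
  (`IsTranslationInvariant.re_expect_localPairAt_sq_le_re_boxAverage_dWavePairCorr`, hubbard-cq-p4).
* `IsMeanEnergyMinimiser.sq_half_leftDeriv_le_re_boxAverage_dWavePairCorr`: the same as a dot-notation theorem.

HONEST SCOPE: a T5-class dictionary theorem about INFINITE-VOLUME translation-invariant sourced ground states at
`h > 0` (where the source breaks the symmetry explicitly); it does not bear on torus ground states of the
source-free model and is no CQ bit (transplant-1 census (24)/(44), BN-T5). Everything is PROVED.

## References
* R. B. Griffiths, Phys. Rev. 152 (1966) 240, §II (one-sided derivatives bound the conjugate observable).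
  [cite: Griffiths1966, §II]
* G. L. Sewell, J. Math. Phys. 11 (1970) 1868, §4 (LRO of a translation-invariant state ≥ |order parameter|²).
  [cite: Sewell1970, §4]
* T. Koma, H. Tasaki, J. Stat. Phys. 76 (1994) 745–803, §1. [cite: KomaTasaki1994, §1]
-/

noncomputable section

namespace Literature.MathematicalPhysics.QuantumLattice

open _root_.Matrix Finset Complex Literature.Probability.LatticeModels _root_.Filter Set
open scoped _root_.Topology ComplexOrder

/-- **FLOOR** (the statement, item (F) of the transplant lens's Sketch 4): for `h > 0`, every translation-invariant
ground state `ω` of the sourced pencil `Ψ_h` has `d`-wave pair LRO at least the square of the smaller Griffiths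
amplitude, in every box: `(∂⁻E(h)/2)² ≤ Re N⁻⁴ Σ_{x,y∈[0,N)²} ω(P_x^d⋆ P_y^d)` (`N ≥ 1`).
[cite: Griffiths1966, §II] -/
def SourcedGroundStatePairLROFloor (t' U μ : ℝ) : Prop :=
  ∀ ⦃h : ℝ⦄, 0 < h → ∀ ⦃ω : InfVolFermionState 2⦄,
    ω.IsMeanEnergyMinimiser (hubbardTTPrimeSourcedInteraction 1 t' U μ dWaveFormFactor h) 1 →
    ∀ ⦃N : ℕ⦄, N ≠ 0 →
      (derivWithin (dWaveSourceEnergyDensityTT' t' U μ) (Iio h) h / 2) ^ 2 ≤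
        (((N : ℂ) ^ 4)⁻¹ * ∑ x ∈ halfOpenBox 2 N, ∑ y ∈ halfOpenBox 2 N, ω.dWavePairCorr x y).re

/-- The left derivative of `E` at `h > 0` is `≤ 0` (`E` is antitone on `[0, ∞)`). [cite: Griffiths1966, §II] -/
theorem leftDeriv_dWaveSourceEnergyDensityTT'_nonpos (t' U μ : ℝ) {h : ℝ} (hh : 0 < h) :
    derivWithin (dWaveSourceEnergyDensityTT' t' U μ) (Iio h) h ≤ 0 := by
  have hd := (hasDerivWithinAt_Ioi_Iio_dWaveSourceEnergyDensityTT' t' U μ h).2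
  have ht : Tendsto (slope (dWaveSourceEnergyDensityTT' t' U μ) h) (𝓝[<] h)
      (𝓝 (derivWithin (dWaveSourceEnergyDensityTT' t' U μ) (Iio h) h)) := by
    have := hasDerivWithinAt_iff_tendsto_slope.1 hd
    rwa [show Iio h \ {h} = Iio h from by simp] at this
  refine le_of_tendsto ht ?_
  filter_upwards [Ioo_mem_nhdsLT hh] with s hs
  rw [slope_def_field]
  have hnum : 0 ≤ dWaveSourceEnergyDensityTT' t' U μ s - dWaveSourceEnergyDensityTT' t' U μ h :=
    sub_nonneg.2 (dWaveSourceEnergyDensityTT'_anti t' U μ hs.1.le hs.2.le)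
  have hden : s - h < 0 := sub_neg.2 hs.2
  exact div_nonpos_iff.2 (Or.inl ⟨hnum, hden.le⟩)

/-- **The floor, dot-notation form**: for a translation-invariant ground state `ω` of `Ψ_h`, `h > 0`, and `N ≥ 1`,
`(∂⁻E(h)/2)² ≤ boxLRO_N(ω)`. [cite: Sewell1970, §4] -/
theorem InfVolFermionState.IsMeanEnergyMinimiser.sq_half_leftDeriv_le_re_boxAverage_dWavePairCorr
    {t' U μ h : ℝ} (hh : 0 < h) {ω : InfVolFermionState 2}
    (hω : ω.IsMeanEnergyMinimiser (hubbardTTPrimeSourcedInteraction 1 t' U μ dWaveFormFactor h) 1)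
    {N : ℕ} (hN : N ≠ 0) :
    (derivWithin (dWaveSourceEnergyDensityTT' t' U μ) (Iio h) h / 2) ^ 2 ≤
      (((N : ℂ) ^ 4)⁻¹ * ∑ x ∈ halfOpenBox 2 N, ∑ y ∈ halfOpenBox 2 N, ω.dWavePairCorr x y).re := by
  have hIcc := hω.two_mul_re_expect_localPairAt_mem_Icc
  have hneg := leftDeriv_dWaveSourceEnergyDensityTT'_nonpos t' U μ hh
  have hre := InfVolFermionState.IsTranslationInvariant.re_expect_localPairAt_sq_le_re_boxAverage_dWavePairCorr
    hω.1 hN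
  refine le_trans ?_ hre
  have h1 : -derivWithin (dWaveSourceEnergyDensityTT' t' U μ) (Iio h) h / 2 ≤
      (ω.expect (pairRegion (insert (0 : Site 2) unitSteps) 0)
        (localPairAt (insert 0 unitSteps) dWaveFormFactor 0)).re := by
    linarith [hIcc.1]
  have h0 : 0 ≤ -derivWithin (dWaveSourceEnergyDensityTT' t' U μ) (Iio h) h / 2 := by linarith
  calc (derivWithin (dWaveSourceEnergyDensityTT' t' U μ) (Iio h) h / 2) ^ 2
      = (-derivWithin (dWaveSourceEnergyDensityTT' t' U μ) (Iio h) h / 2) ^ 2 := by ring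
    _ ≤ _ := pow_le_pow_left₀ h0 h1 2

/-- **The floor holds** (item (F) of Sketch 4, unconditionally). [cite: Griffiths1966, §II] -/
theorem sourcedGroundStatePairLROFloor_holds (t' U μ : ℝ) : SourcedGroundStatePairLROFloor t' U μ :=
  fun _ hh _ hω _ hN => hω.sq_half_leftDeriv_le_re_boxAverage_dWavePairCorr hh hN

end Literature.MathematicalPhysics.QuantumLattice
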